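import Summits.BirchSwinnertonDyer.Rank1Residual.GaloisImage.KatoAvatarEulerFactorFamily
import Summits.BirchSwinnertonDyer.Rank1Residual.GaloisImage.GroupRingEulerFactorComparison
import Mathlib.NumberTheory.Padics.PadicIntegers
import HarnessLib

/-!
# The derivative expansion of `(1 + δ₋₁)·n·X − V·Θ_n` in `ℚ[(ℤ/n)ˣ]` (Kato's zeta value against the
# twisted Mazur–Tate element; PK-4b-C3 instantiated)
# (cell `b2b-bsdres`, team n1011, ROUTE-1 PORT anatomy (P-KIM); R1-71/R1-72: PK-4b
# `KatoZetaValueDerivativeCongruence`, layer PK-4b-C4b-2 (iii); seat p15 GEN 10)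

HONEST FRAMING (cell `b2b-bsdres`, run/shared/lean/b2b/bsd-rank1-residual/, verbatim in every
file): the goal of the cell is to DELETE the COMBINATION-SHAPED residual classes of the
Birch–Swinnerton-Dyer formula for ALL analytic-rank `≤ 1` elliptic curves over `ℚ` — "full BSD
formula for every rank `≤ 1` curve in class `C`" assembled STRICTLY from published theorems — so
that the rank-`≤ 1` remainder becomes exactly the CONSTRUCTION-SHAPED classes, which are TYPED
(missing-input `Prop`s), NOT attempted. This is not "finishing BSD". Team n1011 (N10/N11; ROUTE 1,
the PORT anatomy (P-KIM) of class X4 ∧ `p = 3`): research route on CONSTRUCTION-SHAPED classes;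
prove what is provable now; no claim beyond stated classes; census output = EVIDENCE, never a
Literature fact; RESIDUAL-MAP marks UNCHANGED; nothing is booked by this file. TOOL THEOREMS ONLY:
no definition, no named fact, no instance, no `sorry`; Kato's value law enters as the DISPLAYED
hypothesis `hval` (PK-4a's literal conclusion shape).

## What

`n = ∏_i ℓ_i` distinct primes `∤ N` (`ι` finite), `G = (ℤ/n)ˣ`, `f` a rational newform
(`IsNewform0 f`, `coeffField f = ⊥`, `a_i = a_{ℓ_i}(f) ∈ ℤ`), `x ∈ ℚ(ζ_n)` with PK-4a's character sums
(`hval`, depletion modulus `n·M`, `(M, n) = 1`) and avatar `X ∈ ℚ[G]` (`x = Σ_g X_g σ_g ζ_n`).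
Group-ring data in `ℚ[G]`: norms `N_i` of `H_i = ker(G → (ℤ/(n/ℓ_i))ˣ)`, derivatives
`D_i = Σ_{j<ℓ_i−1} j δ_{b_i^j}` (`b_i ∈ H_i`), `g_i = (ℓ_i − 2)/2`, the `n`-normalised Kato factors
`K_i = a_i − δ_{λ_i⁻¹} − ℓ_i δ_{λ_i}`, the Mazur–Tate factors `M_i = a_i − δ_{λ_i} − δ_{λ_i⁻¹}`
(`λ_i ↦ ℓ_i mod n/ℓ_i`), the twist `V = (1 + δ₋₁) · κδ_{u⁻¹} · E · C⁻` (depletion and cusp elements of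
`KatoAvatarComponents`) and the pull-backs `Θ_d = Σ_g [π_d(g)/n_d]⁺_f δ_g` of `θ̃_f(n_d)`.
★ `prod_deriv_mul_plusAvatar_sub_eq_sum` — THE EXPANSION in `ℚ[G]`:
`(∏_i D_i) · ((1 + δ₋₁)·n·X − V·Θ_univ) = Σ_{∅≠U} (∏_U g_i)(∏_{∉U}(D_i − g_i N_i))((∏_U K_i − ∏_U M_i)·V·Θ_{univ∖U})`
— PK-4b-C3 `prod_deriv_mul_sub_eq_sum_of_generated` over `ℂ[G]` with `hX` =
`mapRingHom_plusAvatar_eq_family` (PK-4b-C4b-2 (ii)) and `hY` = PK-4b-C4b-1 `exists_pullback_eq_family`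
twisted by `V`, pulled back along the injection `ℚ[G] ↪ ℂ[G]` (the datum `Θ̂` and `B = V·Θ̂` live in
`ℂ[G]` and have disappeared from the statement). §1: small conversions (base change of constants,
`g_i = (ℓ_i − 1)⁻¹ Σ_{j<ℓ_i−1} j`, the full-level pull-back). Consumer: the congruence
`KatoZetaValueDerivativeCongruence` (integrality reading ⇒ T-PK6-VAL's `hmem`).
HONEST LIMITS: `hval` displayed (PK-4a `charSum_eq_of_even` discharges it from `ZetaBody` at
`n = cycLevel p 0 r`, `M = p·A`); no integrality here; closes nothing; books nothing.

References: K. Kato, Astérisque 295 (2004) Thm. 6.6 (1) p. 163, §6.2 p. 161 [Kato2004Asterisque];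
K. Rubin, *Euler Systems* (2000) §4.4, §9.6 [Rubin2000]; K. Ota, arXiv:1509.00682 Prop. 2.3 (1) [Ota2018];
r1 ROUTE-1 §55–57 R1-71/R1-72 (cells/n1011/ROUTE-1.md); `HOME/b2b-bsdres-n1011-p15/g9/pk4/PK4b-C4-DESIGN.md`.
-/

noncomputable section

namespace Summit.BirchSwinnertonDyer.Rank1Residual.GaloisImage

namespace EulerFactorComparison

open Finset MonoidAlgebra
open scoped BigOperators
open Literature.NumberTheory.EllipticCurves Literature.NumberTheory.EllipticCurves.ModularForms
open Literature.NumberTheory.EllipticCurves.Kato2004.EulerSystemValues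
open CongruenceSubgroup

variable {ι : Type*} [Fintype ι] [DecidableEq ι] (ℓ : ι → ℕ) [hℓ : ∀ i, Fact (ℓ i).Prime]
  (hinj : Function.Injective ℓ) {n : ℕ} [NeZero n] (hn : ∏ i, ℓ i = n)
  {N : ℕ} [NeZero N] (f : CuspForm (Gamma0 N) 2)

/-! ### §1 Small conversions -/

omit [NeZero n] in
/-- Base change `ℚ → L` of a rational constant of the group ring. [folklore] -/
theorem mapRingHom_algebraMap_algebraMap {L : Type*} [Field L] [CharZero L] (q : ℚ) :
    MonoidAlgebra.mapRingHom (ZMod n)ˣ (algebraMap ℚ L) (algebraMap ℚ _ q) =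
      algebraMap L (MonoidAlgebra L (ZMod n)ˣ) (q : L) := by
  rw [MonoidAlgebra.coe_algebraMap, MonoidAlgebra.coe_algebraMap, Function.comp_apply, Function.comp_apply,
    MonoidAlgebra.mapRingHom_single, Algebra.algebraMap_self_apply, Algebra.algebraMap_self_apply, eq_ratCast]

omit [NeZero n] in
/-- Base change `ℤ_p → ℚ_p` of an integral constant of the group ring. [folklore] -/
theorem mapRingHom_coe_algebraMap {p : ℕ} [Fact p.Prime] (z : ℤ_[p]) :
    MonoidAlgebra.mapRingHom (ZMod n)ˣ (PadicInt.Coe.ringHom (p := p)) (algebraMap ℤ_[p] _ z) =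
      algebraMap ℚ_[p] (MonoidAlgebra ℚ_[p] (ZMod n)ˣ) (z : ℚ_[p]) := by
  rw [MonoidAlgebra.coe_algebraMap, MonoidAlgebra.coe_algebraMap, Function.comp_apply, Function.comp_apply,
    MonoidAlgebra.mapRingHom_single, Algebra.algebraMap_self_apply, Algebra.algebraMap_self_apply]
  rfl

omit [NeZero n] in
/-- An element of a group ring over a finite group is the sum of its monomials. [folklore] -/
theorem eq_sum_single_coeff {R : Type*} [Semiring R] (Z : MonoidAlgebra R (ZMod n)ˣ) [Fintype (ZMod n)ˣ] :
    Z = ∑ g : (ZMod n)ˣ, single g (Z.coeff g) := by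
  classical
  conv_lhs => rw [← MonoidAlgebra.sum_coeff_single Z]
  rw [Finsupp.sum_fintype]
  intro b
  simp

omit [Fintype ι] [DecidableEq ι] in
/-- `g_i = (ℓ_i − 1)⁻¹ · Σ_{j<ℓ_i−1} j = (ℓ_i − 2)/2`. [folklore] -/
theorem inv_mul_sum_range_eq (i : ι) :
    (((ℓ i - 1 : ℕ) : ℂ))⁻¹ * ((∑ j ∈ range (ℓ i - 1), j : ℕ) : ℂ) = ((((ℓ i : ℚ) - 2) / 2 : ℚ) : ℂ) := by
  have h2 : 2 ≤ ℓ i := (hℓ i).out.two_le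
  have hsum := Finset.sum_range_id_mul_two (ℓ i - 1)
  have h1 : (((ℓ i - 1 : ℕ)) : ℂ) = (ℓ i : ℂ) - 1 := by
    rw [Nat.cast_sub (by omega), Nat.cast_one]
  have h1' : (((ℓ i - 1 - 1 : ℕ)) : ℂ) = (ℓ i : ℂ) - 2 := by
    rw [show ℓ i - 1 - 1 = ℓ i - 2 by omega, Nat.cast_sub h2, Nat.cast_two]
  have hs : ((∑ j ∈ range (ℓ i - 1), j : ℕ) : ℂ) * 2 = ((ℓ i : ℂ) - 1) * ((ℓ i : ℂ) - 2) := by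
    rw [← h1, ← h1']; exact_mod_cast hsum
  have hne : (ℓ i : ℂ) - 1 ≠ 0 := by
    rw [← h1]; exact_mod_cast (Nat.sub_pos_of_lt (hℓ i).out.one_lt).ne'
  rw [h1, Rat.cast_div, Rat.cast_sub, Rat.cast_natCast, Rat.cast_ofNat]
  field_simp
  linear_combination hs

omit [Fintype ι] [DecidableEq ι] hℓ in
/-- The value under the reduction map at the full level is the value: for `m = n`,
`val(π_m g) = val(g)`. [folklore] -/
theorem val_unitsMap_eq_of_eq {m : ℕ} (hmn : m = n) (h : m ∣ n) (g : (ZMod n)ˣ) :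
    ((ZMod.unitsMap h g : (ZMod m)ˣ) : ZMod m).val = (g : ZMod n).val := by
  subst hmn
  rw [ZMod.unitsMap_def, Units.coe_map, MonoidHom.coe_coe, ZMod.castHom_apply, ZMod.cast_id', id]

/-! ### §2 ★ The expansion in `ℚ[(ℤ/n)ˣ]` -/

set_option backward.isDefEq.respectTransparency false in
include hinj in
/-- **★ THE EXPANSION in `ℚ[(ℤ/n)ˣ]`.** With the data of the module docstring (value law `hval`
DISPLAYED; `K_i` the `n`-normalised Kato factors, `M_i` the Mazur–Tate factors, `V` the twist,
`Θ_d` the pull-backs of `θ̃_f(n_d)`, `D_i` the derivatives on `b_i ∈ H_i` of length `ℓ_i − 1`,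
`g_i = (ℓ_i − 2)/2`):
`(∏_i D_i)·(n·(1 + δ₋₁)·X − V·Θ_univ) = Σ_{∅≠U} (∏_U g_i)(∏_{∉U}(D_i − g_i N_i))((∏_U K_i − ∏_U M_i)·(V·Θ_{univ∖U}))`.
PK-4b-C3 over `ℂ` (`hX`: C4b-2 (ii); `hY`: C4b-1 twisted by `V`), pulled back along `ℚ[G] ↪ ℂ[G]`.
[cite: Kato2004Asterisque, Thm. 6.6 (1) (p. 163) and §6.2 (p. 161)] [cite: Rubin2000, §9.6 and §4.4]
[cite: Ota2018, Prop. 2.3 (1)] -/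
theorem prod_deriv_mul_plusAvatar_sub_eq_sum (hf : IsNewform0 f) (hQ : coeffField f = ⊥)
    (hℓN : ∀ i, ¬ ℓ i ∣ N) (aℓ : ι → ℤ) (ha : ∀ i, cuspCoeff f (ℓ i) = aℓ i)
    (x : CyclotomicField n ℚ) (X : MonoidAlgebra ℚ (ZMod n)ˣ)
    (hxX : x = ∑ g : (ZMod n)ˣ, X.coeff g •
      sigma n g (IsCyclotomicExtension.zeta n ℚ (CyclotomicField n ℚ)))
    (ιe : CyclotomicField n ℚ →+* ℂ) (u : (ZMod n)ˣ)
    (hι : ιe (IsCyclotomicExtension.zeta n ℚ (CyclotomicField n ℚ)) =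
      Complex.exp (2 * Real.pi * Complex.I * ((u : ZMod n).val : ℂ) / n))
    (κ : ℚ) {M : ℕ} (hM0 : M ≠ 0) (hM : M.Coprime n) (c d a : ℤ) (A : ℕ) (d' : ℤ)
    (hval : ∀ {n₀ : ℕ} [NeZero n₀] (hn₀ : n₀ ∣ n) {χ₀ : DirichletCharacter ℂ n₀},
      χ₀.IsPrimitive → χ₀ (-1) = 1 →
      charSum n ιe (DirichletCharacter.changeLevel hn₀ χ₀) x =
        (κ : ℂ) * ((∏ q ∈ (n * M).primeFactors.filter (fun q => ¬ q ∣ n₀),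
            (1 - χ₀ (q : ZMod n₀) * cuspCoeff f q * (q : ℂ) ^ (-(1 : ℂ)) +
              (if q ∣ N then 0 else (q : ℂ)) * χ₀ (q : ZMod n₀) ^ 2 * ((q : ℂ) ^ (-(1 : ℂ))) ^ 2)) *
          ((∑ b : ZMod n₀, χ₀⁻¹ b * ((ratPlusSymbol f ((b.val : ℚ) / n₀) : ℚ) : ℂ)) /
            gaussSum χ₀⁻¹ (ZMod.stdAddChar (N := n₀)))) *
        cuspFactor f true (fun j => (DirichletCharacter.changeLevel hn₀ χ₀)⁻¹ (j : ZMod n)) c d a A d')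
    (lam : ι → (ZMod n)ˣ)
    (hlam : ∀ j, ((ZMod.unitsMap (prod_dvd_of_prod_eq ℓ hn (univ.erase j)) (lam j) :
      (ZMod (∏ i ∈ univ.erase j, ℓ i))ˣ) : ZMod (∏ i ∈ univ.erase j, ℓ i)) =
        (ℓ j : ZMod (∏ i ∈ univ.erase j, ℓ i)))
    (b : ι → (ZMod n)ˣ) (hb : ∀ i, b i ∈ (ZMod.unitsMap (prod_dvd_of_prod_eq ℓ hn (univ.erase i))).ker)
    (Nq Dq gq Kq Mq : ι → MonoidAlgebra ℚ (ZMod n)ˣ)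
    (hNq : ∀ i, Nq i = ∑ h ∈ univ.filter (· ∈ (ZMod.unitsMap (prod_dvd_of_prod_eq ℓ hn (univ.erase i))).ker),
      single h (1 : ℚ))
    (hDq : ∀ i, Dq i = ∑ j ∈ range (ℓ i - 1), single (b i ^ j) ((j : ℕ) : ℚ))
    (hgq : ∀ i, gq i = algebraMap ℚ _ (((ℓ i : ℚ) - 2) / 2))
    (hKq : ∀ i, Kq i = algebraMap ℚ _ (aℓ i : ℚ) - single (lam i)⁻¹ (1 : ℚ) - single (lam i) (ℓ i : ℚ))
    (hMq : ∀ i, Mq i = algebraMap ℚ _ (aℓ i : ℚ) - single (lam i) (1 : ℚ) - single (lam i)⁻¹ (1 : ℚ))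
    (uq : ℕ → (ZMod n)ˣ) (huq : ∀ q ∈ M.primeFactors, ((uq q : (ZMod n)ˣ) : ZMod n) = q)
    (aM : ℕ → ℤ) (haM : ∀ q ∈ M.primeFactors, cuspCoeff f q = aM q)
    (Eq : MonoidAlgebra ℚ (ZMod n)ˣ)
    (hEq : Eq = ∏ q ∈ M.primeFactors, (1 - single (uq q)⁻¹ ((aM q : ℚ) / q) +
      single ((uq q)⁻¹ ^ 2) (if q ∣ N then 0 else (1 / q : ℚ))))
    (uc ud : (ZMod n)ˣ) (huc : (uc : ZMod n) = c) (hud : (ud : ZMod n) = d)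
    (Cq : MonoidAlgebra ℚ (ZMod n)ˣ)
    (hCq : Cq = algebraMap ℚ _ ((c : ℚ) ^ 2 * (d : ℚ) ^ 2 * ratMinusSymbol f ((a : ℚ) / A)) -
      single uc ((c : ℚ) * (d : ℚ) ^ 2 * ratMinusSymbol f ((a * c : ℚ) / A)) -
      single ud ((c : ℚ) ^ 2 * (d : ℚ) * ratMinusSymbol f ((a * d' : ℚ) / A)) +
      single (uc * ud) ((c : ℚ) * (d : ℚ) * ratMinusSymbol f ((a * c * d' : ℚ) / A)))
    (Vq : MonoidAlgebra ℚ (ZMod n)ˣ)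
    (hVq : Vq = (1 + single (-1 : (ZMod n)ˣ) (1 : ℚ)) * single u⁻¹ κ * Eq * Cq)
    (Θq : Finset ι → MonoidAlgebra ℚ (ZMod n)ˣ)
    (hΘq : ∀ d : Finset ι,
      haveI : NeZero (∏ i ∈ d, ℓ i) := ⟨Finset.prod_ne_zero_iff.mpr fun i _ => (hℓ i).out.ne_zero⟩
      Θq d = ∑ g : (ZMod n)ˣ, single g (ratPlusSymbol f
        ((((ZMod.unitsMap (prod_dvd_of_prod_eq ℓ hn d) g : (ZMod (∏ i ∈ d, ℓ i))ˣ) :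
          ZMod (∏ i ∈ d, ℓ i)).val : ℚ) / (∏ i ∈ d, ℓ i : ℕ)))) :
    (∏ i, Dq i) * ((n : ℚ) • ((1 + single (-1 : (ZMod n)ˣ) (1 : ℚ)) * X) - Vq * Θq univ) =
      ∑ U ∈ (univ : Finset ι).powerset.erase ∅, (∏ i ∈ U, gq i) *
        ((∏ i ∈ univ \ U, (Dq i - gq i * Nq i)) *
          (((∏ i ∈ U, Kq i) - ∏ i ∈ U, Mq i) * (Vq * Θq (univ \ U)))) := by
  classical
  apply mapRingHom_algebraMap_injective n
  set φ := MonoidAlgebra.mapRingHom (ZMod n)ˣ (algebraMap ℚ ℂ) with hφ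
  have hℓ1 : ∀ j, (((ℓ j - 1 : ℕ)) : ℂ) ≠ 0 := fun j => by
    exact_mod_cast (Nat.sub_pos_of_lt (hℓ j).out.one_lt).ne'
  -- the complexified data, in the literal shapes of PK-4b-C3
  have hNc : ∀ i, φ (Nq i) =
      ∑ h ∈ univ.filter (· ∈ (ZMod.unitsMap (prod_dvd_of_prod_eq ℓ hn (univ.erase i))).ker),
        single h (1 : ℂ) := fun i => by
    rw [hNq i, map_sum]
    exact Finset.sum_congr rfl fun h _ => by rw [MonoidAlgebra.mapRingHom_single, map_one]
  have hDc : ∀ i, φ (Dq i) = ∑ j ∈ range (ℓ i - 1), single (b i ^ j) ((j : ℕ) : ℂ) := fun i => by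
    rw [hDq i, map_sum]
    exact Finset.sum_congr rfl fun j _ => by rw [MonoidAlgebra.mapRingHom_single, map_natCast]
  have hgc : ∀ i, φ (gq i) = ((((ℓ i - 1 : ℕ) : ℂ))⁻¹ * ((∑ j ∈ range (ℓ i - 1), j : ℕ) : ℂ)) •
      (1 : MonoidAlgebra ℂ (ZMod n)ˣ) := fun i => by
    rw [hgq i, mapRingHom_algebraMap_algebraMap, ← inv_mul_sum_range_eq ℓ i, Algebra.algebraMap_eq_smul_one]
  have hMc : ∀ j, φ (Mq j) = algebraMap ℂ (MonoidAlgebra ℂ (ZMod n)ˣ) ((aℓ j : ℤ) : ℂ) -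
      single (lam j) 1 - single (lam j)⁻¹ 1 := fun j => by
    rw [hMq j, map_sub, map_sub, mapRingHom_algebraMap_algebraMap, MonoidAlgebra.mapRingHom_single,
      MonoidAlgebra.mapRingHom_single, map_one, Rat.cast_intCast]
  have hw : ∀ i, (((ℓ i - 1 : ℕ) : ℂ))⁻¹ *
      (((univ.filter (· ∈ (ZMod.unitsMap (prod_dvd_of_prod_eq ℓ hn (univ.erase i))).ker)).card : ℕ) : ℂ) =
        1 := fun i => by
    rw [card_ker_unitsMap_prod ℓ hinj hn (univ.erase i), univ_sdiff_erase, Finset.prod_singleton,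
      inv_mul_cancel₀ (hℓ1 i)]
  -- the Mazur–Tate datum (PK-4b-C4b-1) and `hY`
  obtain ⟨Θ, hΘ⟩ := exists_pullback_eq_family ℓ hinj hn f hf hQ hℓN aℓ ha lam hlam
    (fun j => φ (Nq j)) (fun j => (((ℓ j - 1 : ℕ) : ℂ))⁻¹ • φ (Nq j)) (fun j => φ (Mq j)) hNc
    (fun _ => rfl) hMc
  have hΘc : ∀ d : Finset ι,
      haveI : NeZero (∏ i ∈ d, ℓ i) := ⟨Finset.prod_ne_zero_iff.mpr fun i _ => (hℓ i).out.ne_zero⟩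
      φ (Θq d) = ∑ g : (ZMod n)ˣ, single g (algebraMap ℚ ℂ (ratPlusSymbol f
        ((((ZMod.unitsMap (prod_dvd_of_prod_eq ℓ hn d) g : (ZMod (∏ i ∈ d, ℓ i))ˣ) :
          ZMod (∏ i ∈ d, ℓ i)).val : ℚ) / (∏ i ∈ d, ℓ i : ℕ)))) := fun d => by
    rw [hΘq d, map_sum]
    exact Finset.sum_congr rfl fun g _ => by rw [MonoidAlgebra.mapRingHom_single]
  have hVc : φ Vq = (1 + single (-1 : (ZMod n)ˣ) (1 : ℂ)) * single u⁻¹ (κ : ℂ) * φ Eq * φ Cq := by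
    rw [hVq, map_mul, map_mul, map_mul, map_add, map_one, MonoidAlgebra.mapRingHom_single,
      MonoidAlgebra.mapRingHom_single, map_one, eq_ratCast]
  have hY : ∀ d : Finset ι, φ Vq * φ (Θq d) =
      (∏ j ∈ univ \ d, φ (Nq j)) *
        (∏ i ∈ d, ((((ℓ i - 1 : ℕ) : ℂ))⁻¹ • φ (Nq i) * φ (Mq i) + (1 - (((ℓ i - 1 : ℕ) : ℂ))⁻¹ • φ (Nq i)))) *
        ((1 + single (-1 : (ZMod n)ˣ) (1 : ℂ)) * single u⁻¹ (κ : ℂ) * φ Eq * φ Cq * Θ) := fun d => by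
    rw [hΘc d, hΘ d, hVc]
    ring
  -- `hX` (PK-4b-C4b-2 (ii))
  have hX := mapRingHom_plusAvatar_eq_family ℓ hinj hn f hℓN aℓ ha x X hxX ιe u hι (κ : ℂ) hM0 hM c d a A d'
    hval lam hlam (fun j => φ (Nq j)) (fun j => (((ℓ j - 1 : ℕ) : ℂ))⁻¹ • φ (Nq j)) (fun j => φ (Mq j)) hNc
    (fun _ => rfl) Θ hΘ Kq hKq uq huq aM haM Eq hEq uc ud huc hud Cq hCq
  -- PK-4b-C3 over `ℂ`
  have hC3 := prod_deriv_mul_sub_eq_sum_of_generated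
    (fun i => (ZMod.unitsMap (prod_dvd_of_prod_eq ℓ hn (univ.erase i))).ker) b (fun i => ℓ i - 1)
    (fun i => (((ℓ i - 1 : ℕ) : ℂ))⁻¹) (fun i => φ (Nq i)) (fun i => φ (Dq i))
    (fun j => (((ℓ j - 1 : ℕ) : ℂ))⁻¹ • φ (Nq j)) (fun i => φ (gq i)) (fun i => φ (Kq i)) (fun i => φ (Mq i))
    ((1 + single (-1 : (ZMod n)ˣ) (1 : ℂ)) * single u⁻¹ (κ : ℂ) * φ Eq * φ Cq * Θ)
    (φ ((n : ℚ) • ((1 + single (-1 : (ZMod n)ˣ) (1 : ℚ)) * X)))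
    (fun d => φ Vq * φ (Θq d)) hNc hDc hb hw (fun _ => rfl) hgc hX hY
  rw [map_mul, map_sub, map_prod, map_mul]
  simp only [map_sum, map_mul, map_prod, map_sub]
  exact hC3

end EulerFactorComparison

end Summit.BirchSwinnertonDyer.Rank1Residual.GaloisImage

end
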